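import Summits.QuantumAdvantage.AdviceFreeQNC0.KernelFibrationMoves
import Mathlib.Algebra.Field.ZMod
import HarnessLib

/-!
# Cell qa-qnc0 — 𝔽₂-AFFINE STAKES: the coin-pair identity (step 1) and the NULL family (step 4d)
(planner qa-qnc0-p1 g19, ROUND-18 §3.6; `exp19/Sketch19.lean` §6, definitions VERBATIM)

The rung `AffineStakesHardOdd3` (Sketch19 §6): every polylog-weight `𝔽₂`-affine stake strategy
`z_j = t_j(x) ⊕ c_j ⊕ ⊕_{i : A j i} x_i` satisfies the ring relation on at most `θ₀·2^{n-1}` odd patterns.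
This file types the §6 vocabulary (`rowParity`, `affineStrategy`, `rowWeight`, `AffineStakesHardOdd3`)
and proves two of the four steps of the planner's proof (ROUND-18 §3.6):

* `win_flipPair_affine` (step 1) — under the coin-pair flip at particles `p ≠ p'` the win bit of an
  affine strategy changes by `|supp J ∩ T_{pp'}| mod 2`, `T_{pp'} = {k : A k p ≠ A k p'}` — a function of
  `J` ALONE (from `win_transport` + `kline_flipPair`: the `t`-part and the constants cancel, each row
  parity changes by `A k p ⊕ A k p'`);
* `win_nullAffine` (step 4d) — the NULL radius-1 family
  `b_j = α_j x_{j-1} + β_j x_j + α_{j+2} x_{j+1} + (β_{j-1} + β_{j+1} + α_j + α_{j+2})` NEVER wins: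
  `⟨J(x), b(x)⟩ ≡ 0`; in fact `⟨v, b(x)⟩ ≡ 0` for EVERY kernel vector `v ∈ K(x)` of every pattern
  (`dot2_nullAffine_of_inKernel`): after reindexing, the `β`-terms are `β_j·(v_j x_j + v_{j-1} + v_{j+1}) = 0`
  (kernel equation at `j`) and the `α`-terms are `α_j (x_{j-1}+1)(v_j + v_{j-2}) = α_j (x_{j-1}+1) x_{j-1} v_{j-1} = 0`
  (kernel equation at `j-1`, `X(X+1) = 0` in `𝔽₂`).

Steps (2) (`hardcoreToggle`, `HardcoreToggle.lean`) and the engine (`hardcoreCylinderLB`) are landed;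
steps (3)–(4a,b,c) and the assembly `affineStakesHardOdd3_of` are NOT here.

WHAT THIS IS NOT: `AffineStakesHardOdd3` is not proved here; crux 22907 untouched; separation NOT moved.
-/

namespace Summit.QuantumAdvantage.AdviceFreeQNC0.Fib19

open Finset Literature.Computability.QuantumComplexity Literature.Computability.QuantumComplexity.RingHLF

variable {n : ℕ}

/-! ### §6 vocabulary (Sketch19 §6, verbatim) -/

/-- Parity of the bits of `x` selected by the row `a`. -/
def rowParity (a x : Fin n → Bool) : Bool :=
  decide ((univ.filter fun i : Fin n => a i = true ∧ x i = true).card % 2 = 1)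

/-- The 𝔽₂-affine stake strategy with read-matrix `A` and constants `c`:
output `z_j = t_j(x) ⊕ c_j ⊕ ⊕_{i : A j i} x_i`. -/
def affineStrategy (A : Fin n → Fin n → Bool) (c : Fin n → Bool) (x : Fin n → Bool) : Fin n → Bool :=
  fun j => xor (tGuess x j) (xor (c j) (rowParity (A j) x))

/-- Row weight of the read-matrix. -/
def rowWeight (A : Fin n → Fin n → Bool) (j : Fin n) : ℕ := (univ.filter fun i : Fin n => A j i = true).card

/-- **RUNG `AffineStakesHardOdd3`** (ROUND-18 §3.6): some absolute `θ < 1` bounds the number of odd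
patterns on which ANY polylog-weight 𝔽₂-affine stake strategy satisfies the ring relation.  A literal
sub-case of `RingHardOdd 3` (same quantifier shape); contains the far dictators (§5), `b = x`, sums of
far bits, … ; unbounded read multiplicity allowed.  (Sketch19 §6, verbatim.) -/
def AffineStakesHardOdd3 : Prop :=
  open scoped Classical in
  ∃ θ : ℝ, θ < 1 ∧ ∀ c : ℕ, ∃ n₀ : ℕ, ∀ n ≥ n₀, ∀ A : Fin n → Fin n → Bool, ∀ cv : Fin n → Bool,
    (∀ j, rowWeight A j ≤ (Nat.log 2 n) ^ c) →
      ((univ.filter fun x : Fin n → Bool => OddZeros x ∧ Rel x (affineStrategy A cv x)).card : ℝ)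
        ≤ θ * (2 : ℝ) ^ (n - 1)

/-! ### Step (1): the coin-pair identity for affine stakes -/

/-- Bookkeeping: a parity after a change of known parity. -/
private theorem decide_mod_two_of_add {N N' : ℕ} {a b : Bool}
    (h : (N' + N) % 2 = ((if a = true then 1 else 0) + (if b = true then 1 else 0)) % 2) :
    decide (N' % 2 = 1) = xor (decide (N % 2 = 1)) (xor a b) := by
  rcases Nat.mod_two_eq_zero_or_one N with h0 | h0 <;>
    rcases Nat.mod_two_eq_zero_or_one N' with h1 | h1 <;>
      cases a <;> cases b <;> simp [h0, h1] at h ⊢ <;> omega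

/-- A row parity changes under the coin-pair flip by `a p ⊕ a p'`. -/
theorem rowParity_flipPair (a x : Fin n → Bool) {p p' : Fin n} (hpp : p ≠ p') :
    rowParity a (flipAt x {p, p'}) = xor (rowParity a x) (xor (a p) (a p')) := by
  unfold rowParity
  apply decide_mod_two_of_add
  have h := card_filter_flipAt_add_mod_two x (univ.filter fun i : Fin n => a i = true) {p, p'} true
  rw [filter_filter, filter_filter] at h
  rw [h]
  have hI : (univ.filter fun i : Fin n => a i = true) ∩ {p, p'} =
      ({p, p'} : Finset (Fin n)).filter fun i => a i = true := by
    ext i; simp only [mem_inter, mem_filter, mem_univ, true_and, mem_insert, mem_singleton]; tauto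
  rw [hI, card_filter, sum_pair hpp]

/-- The stake of the affine strategy is `c_j ⊕ rowParity (A j) x` (the `t`-part cancels). -/
theorem stake_affineStrategy (A : Fin n → Fin n → Bool) (cv : Fin n → Bool) (x : Fin n → Bool) (j : Fin n) :
    stake (affineStrategy A cv) x j = xor (cv j) (rowParity (A j) x) := by
  unfold stake affineStrategy
  cases tGuess x j <;> cases cv j <;> cases rowParity (A j) x <;> rfl

/-- `dot2` against the zero vector vanishes. -/
theorem dot2_zero_left (z : Fin n → Bool) : dot2 (fun _ => false) z = 0 := by
  unfold dot2
  rw [Finset.filter_eq_empty_iff.2 (fun b _ h => Bool.false_ne_true h.1), card_empty]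

/-- **Step (1) for affine stakes.**  The coin-pair flip at particles `p ≠ p'` changes the win bit of the
affine strategy by a function of `J` alone: the parity of the occupied sites in
`T_{pp'} = {k : A k p ≠ A k p'}` (from `win_transport` + `kline_flipPair`; the `t`-part is invisible). -/
theorem win_flipPair_affine (hn : 3 ≤ n) (A : Fin n → Fin n → Bool) (cv : Fin n → Bool)
    (x : Fin n → Bool) (hodd : IsOdd x) {p p' : Fin n} (hpp : p ≠ p')
    (hp : kline x p = false) (hp' : kline x p' = false) :
    (Rel (flipAt x {p, p'}) (affineStrategy A cv (flipAt x {p, p'})) ↔ Rel x (affineStrategy A cv x)) ↔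
      (univ.filter fun k : Fin n => kline x k = true ∧ A k p ≠ A k p').card % 2 = 0 := by
  obtain ⟨hodd', hJ⟩ := kline_flipPair hn x hodd hpp hp hp'
  rw [win_transport hn (affineStrategy A cv) x (flipAt x {p, p'}) hodd hodd']
  -- the `J`-change term vanishes
  have hΔJ : (fun i => xor (kline (flipAt x {p, p'}) i) (kline x i)) = fun _ => false := by
    funext i; rw [hJ]; cases kline x i <;> rfl
  -- the stake change is the row `k ↦ A k p ⊕ A k p'`
  have hΔb : (fun i => xor (stake (affineStrategy A cv) (flipAt x {p, p'}) i) (stake (affineStrategy A cv) x i))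
      = fun k => xor (A k p) (A k p') := by
    funext k
    rw [stake_affineStrategy, stake_affineStrategy, rowParity_flipPair (A k) x hpp]
    cases cv k <;> cases rowParity (A k) x <;> cases A k p <;> cases A k p' <;> rfl
  rw [hΔJ, hΔb, dot2_zero_left, add_zero]
  have hd : dot2 (kline x) (fun k => xor (A k p) (A k p')) =
      (univ.filter fun k : Fin n => kline x k = true ∧ A k p ≠ A k p').card % 2 := by
    unfold dot2
    congr 2
    ext k
    simp only [mem_filter, mem_univ, true_and, ne_eq]
    cases A k p <;> cases A k p' <;> simp
  rw [hd, Nat.mod_mod]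

/-! ### Step (4d): the NULL affine family never wins -/

/-- The `𝔽₂`-value of a bit. -/
def bitVal (b : Bool) : ZMod 2 := if b then 1 else 0

/-- `bitVal` of an `xor`. -/
theorem bitVal_xor (a b : Bool) : bitVal (xor a b) = bitVal a + bitVal b := by
  cases a <;> cases b <;> decide

/-- `bitVal` of an `and`. -/
theorem bitVal_and (a b : Bool) : bitVal (a && b) = bitVal a * bitVal b := by
  cases a <;> cases b <;> decide

/-- `X(X+1) = 0` in `𝔽₂`. -/
theorem bitVal_mul_add_one (a : Bool) : bitVal a * (bitVal a + 1) = 0 := by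
  cases a <;> decide

/-- `dot2 v z = 0` iff `Σ_j v_j z_j = 0` in `𝔽₂`. -/
theorem dot2_eq_zero_iff_sum (v z : Fin n → Bool) :
    dot2 v z = 0 ↔ ∑ j, bitVal (v j) * bitVal (z j) = 0 := by
  have hsum : (∑ j, bitVal (v j) * bitVal (z j)) =
      ((univ.filter fun b : Fin n => v b = true ∧ z b = true).card : ZMod 2) := by
    rw [natCast_card_filter]
    refine sum_congr rfl fun j _ => ?_
    cases v j <;> cases z j <;> simp [bitVal]
  rw [hsum, ZMod.natCast_eq_zero_iff_even, Nat.even_iff]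
  rfl

/-- The kernel equation at `j`, in `𝔽₂`: `v_{j-1} + v_{j+1} + x_j v_j = 0`. -/
theorem bitVal_kernel {x v : Fin n → Bool} (hv : InKernel x v) (j : Fin n) :
    bitVal (v (prv j)) + bitVal (v (nxt j)) + bitVal (x j) * bitVal (v j) = 0 := by
  have h := congrArg bitVal (hv j)
  rw [bitVal_xor, bitVal_xor, bitVal_and] at h
  exact h

/-- `nxt` is a bijection of the positions. -/
theorem nxt_bijective : Function.Bijective (nxt (n := n)) :=
  Finite.injective_iff_bijective.1 nxt_injective

/-- `prv` is a bijection of the positions. -/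
theorem prv_bijective : Function.Bijective (prv (n := n)) :=
  Finite.injective_iff_bijective.1 prv_injective

/-- **The NULL affine family pairs to zero with EVERY kernel vector** (any pattern `x`, any `v ∈ K(x)`):
`Σ_j v_j b_j(x) = 0` for `b_j = α_j x_{j-1} + β_j x_j + α_{j+2} x_{j+1} + β_{j-1} + β_{j+1} + α_j + α_{j+2}`. -/
theorem dot2_nullAffine_of_inKernel (α β : Fin n → Bool) {x v : Fin n → Bool} (hv : InKernel x v) :
    dot2 v (fun j => xor (xor (α j && x (prv j)) (β j && x j))
      (xor (α (nxt (nxt j)) && x (nxt j))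
        (xor (xor (β (prv j)) (β (nxt j))) (xor (α j) (α (nxt (nxt j))))))) = 0 := by
  rw [dot2_eq_zero_iff_sum]
  -- abbreviations in `𝔽₂`
  set V : Fin n → ZMod 2 := fun j => bitVal (v j) with hV
  set X : Fin n → ZMod 2 := fun j => bitVal (x j) with hX
  set Al : Fin n → ZMod 2 := fun j => bitVal (α j) with hAl
  set Be : Fin n → ZMod 2 := fun j => bitVal (β j) with hBe
  -- expand the summand
  have hexp : ∀ j, bitVal (v j) * bitVal (xor (xor (α j && x (prv j)) (β j && x j))
      (xor (α (nxt (nxt j)) && x (nxt j))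
        (xor (xor (β (prv j)) (β (nxt j))) (xor (α j) (α (nxt (nxt j))))))) =
      (V j * Be j * X j + V j * Al j * X (prv j) + V j * Al j) + V j * Be (prv j) + V j * Be (nxt j) +
        (V j * Al (nxt (nxt j)) * X (nxt j) + V j * Al (nxt (nxt j))) := by
    intro j
    simp only [bitVal_xor, bitVal_and, hV, hX, hAl, hBe]
    ring
  rw [sum_congr rfl fun j _ => hexp j, sum_add_distrib, sum_add_distrib, sum_add_distrib]
  -- reindex the three shifted sums
  have h1 : ∑ j, V j * Be (prv j) = ∑ i, V (nxt i) * Be i := by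
    rw [← nxt_bijective.sum_comp fun j => V j * Be (prv j)]
    simp only [prv_nxt]
  have h2 : ∑ j, V j * Be (nxt j) = ∑ i, V (prv i) * Be i := by
    rw [← prv_bijective.sum_comp fun j => V j * Be (nxt j)]
    simp only [nxt_prv]
  have h3 : ∑ j, (V j * Al (nxt (nxt j)) * X (nxt j) + V j * Al (nxt (nxt j))) =
      ∑ i, (V (prv (prv i)) * Al i * X (prv i) + V (prv (prv i)) * Al i) := by
    rw [← (prv_bijective.comp prv_bijective).sum_comp fun j =>
      V j * Al (nxt (nxt j)) * X (nxt j) + V j * Al (nxt (nxt j))]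
    simp only [Function.comp, nxt_prv]
  rw [h1, h2, h3, ← sum_add_distrib, ← sum_add_distrib, ← sum_add_distrib]
  refine sum_eq_zero fun i _ => ?_
  have k0 := bitVal_kernel hv i
  have k1 := bitVal_kernel hv (prv i)
  rw [nxt_prv] at k1
  have sq := bitVal_mul_add_one (x (prv i))
  simp only [hV, hX, hAl, hBe] at k0 k1 sq ⊢
  linear_combination bitVal (β i) * k0 + bitVal (α i) * (bitVal (x (prv i)) + 1) * k1 -
    bitVal (α i) * bitVal (v (prv i)) * sq

/-- **Step (4d), the NULL affine family**: `b_j = α_j x_{j-1} + β_j x_j + α_{j+2} x_{j+1} + c_j` with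
`c_j = β_{j-1} + β_{j+1} + α_j + α_{j+2}` NEVER wins: `⟨J(x), b(x)⟩ ≡ 0` on the odd class (two
telescoping identities `J_j x_j + J_{j-1} + J_{j+1} ≡ 0` and `(x_{j-1}+1)(J_j + J_{j-2}) ≡ 0`).
(Planner's numerics exp19/nullaffine.py: 0 violations, n = 9..12.) -/
theorem win_nullAffine (hn : 3 ≤ n) (α β : Fin n → Bool) (x : Fin n → Bool) (hodd : IsOdd x) :
    dot2 (kline x) (fun j => xor (xor (α j && x (prv j)) (β j && x j))
      (xor (α (nxt (nxt j)) && x (nxt j))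
        (xor (xor (β (prv j)) (β (nxt j))) (xor (α j) (α (nxt (nxt j))))))) = 0 :=
  dot2_nullAffine_of_inKernel α β (kline_inKernel hn x hodd)

end Summit.QuantumAdvantage.AdviceFreeQNC0.Fib19
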